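import Summits.QuantumFields.YangMills.Theorems.UnitScaleTiltProp7Lane2CutoffFamilyLaplacian
import Summits.QuantumFields.YangMills.Theorems.UnitScaleTiltProp7Lane2PartitionOfUnity
import HarnessLib

/-!
# Route `UnitScaleTilt`, crux «MinimiserStabilityRegPr» (stmt-QuantumFields-19200), E′ ∕ (N06) LANE II «DIVERGENCE RECOVERY AT CURVED `W`» — brick (B6), THE PACKAGE IN (B7-CORE)'s SLOTS:
# ★★★ the cutoffs as ℂ-LINEAR MAPS `Z c : S →ₗ S`, `ZE c : E →ₗ E` (`S = SiteL2K`, `E = BondL2K` of the member) with `Σ_c Z c = 1`, `Σ_c ZE c = 1`, and the two summed commutator rows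
# `‖Σ_c (D_W(Z_c φ_c) − ZE_c(D_W φ_c))‖² ≤ 108·R⁻²·Σ_c‖φ_c‖²`, `‖Σ_c (Δ_W(Z_c φ_c) − Z_c(Δ_W φ_c))‖² ≤ 648·R⁻²·Σ_c‖D_W φ_c‖² + 23328·R⁻⁴·Σ_c‖φ_c‖²`, `R = L^s`, ANY `W`

Cell `ym3-torus`, width seat `ym3-torus-px11` (gen 6); ★p1 g19 SIGNATURE (B7-CORE) 80078390 `Prop7DivRecoveryAssemblyCore.norm_sq_le_rows` (hypotheses `Z hZ ZE hZE` :216 and the slots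
`‖∑ i, (D (Z i (φ i)) - ZE i (D (φ i)))‖²` :223, `‖∑ i, (D†D (Z i (φ i)) - Z i (D†D (φ i)))‖²` :225), «px11 g6: `Z i`∕`ZE i` = your ζ-multiplications as `→ₗ[ℂ]`».  THEOREMS ONLY (0 `def`,
0 `sorry`); `--supports stmt-QuantumFields-19200`, count-neutral.  YM₃ on T³ is a ladder rung (R3), not the Clay problem; nothing here claims (B7), (REC), `hN06`, a stub, the crux, d = 4 or the gap.

WHAT IS PROVED (ns `…Theorems.Prop7Lane2CutoffPackage`; member `F n K`, weight `c₀ > 0`, ANY background `W`, scale exponent `s < m + n`, index type `ι := Site (F.P K) 0` — the maps vanish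
off the centre set, so (B7-CORE)'s `∑ i` over a `Fintype` is met without a subtype):
* §1 `norm_sq_DL2_toL2S_covD` (`‖D_W λ̃‖² = c₀η⁻²Σ_xΣ_μ hs(D_μλ(x))`), `covLapSite_comm_sum_apply` (the family-summed Laplacian commutator on the functions);
* §2 ★★★ `exists_cutoffPackage` — `∃ (ζ) (Zs : ι → S →ₗ[ℂ] S) (Zb : ι → E →ₗ[ℂ] E)` with: (Z1) `Σ_c Zs c φ = φ`, `Σ_c Zb c f = f`; (Z2) the readings `toL2S⁻¹(Zs c φ) x = ζ c x • toL2S⁻¹ φ x`,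
  `toL2⁻¹(Zb c f) b = ζ c b.src • toL2⁻¹ f b` and the seven rows of ✓ `…Lane2PartitionOfUnity.exists_partitionOfUnity` for `ζ` (re-exported: values, tiling, support radius `L^s·L^{K−n}`,
  `≤ 8` alive, steps, second differences); (R1) `∀ φ : ι → S, ‖Σ_c (DL2 W (Zs c (φ c)) − Zb c (DL2 W (φ c)))‖² ≤ 108·((L:ℝ)^s)⁻²·Σ_c‖φ c‖²`;
  (R2) `∀ φ : ι → S, ‖Σ_c (covLapSite W (Zs c (φ c)) − Zs c (covLapSite W (φ c)))‖² ≤ 648·((L:ℝ)^s)⁻²·Σ_c‖DL2 W (φ c)‖² + 23328·(((L:ℝ)^s)²)⁻²·Σ_c‖φ c‖²`.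
MECHANISM: ✓ `…Lane2CutoffFamilyRows.hs_sum_grad_comm_le` ∕ ✓ `…Lane2CutoffFamilyLaplacian.hs_sum_lap_comm_le` at `k = 8`, `a = (3∕2)(Rℓ)⁻¹`, `a₂ = 6(Rℓ)⁻²`, `η⁻¹ = ℓ` (`a²η⁻² = (9∕4)R⁻²`,
`a₂²η⁻⁴ = 36R⁻⁴`), through the pointwise Leibniz identities of ✓ `…Lane2CutoffCommutators` and the (DV)∕∇ dictionaries.  Every numeral ABSOLUTE; nothing reads `K n m W`.
HONEST SCOPE.  Packaging; row 3 (tube commutator) is separate (waits on (B3-TUBE)'s letters); nothing of (B7) is claimed.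

References: T. Bałaban, CMP 99 (1985) 389–434 [Balaban1985BackgroundPropagators] ((3.100) pp.413–414, (3.3) p.391, (3.8) p.392, (3.23) p.394); CMP 96 (1984) 223–250
[Balaban1984PropagatorsII] (p.238).
-/

set_option autoImplicit false

noncomputable section

open scoped BigOperators Matrix.Norms.L2Operator Matrix

namespace Summit.QuantumFields.YangMills.Theorems.Prop7Lane2CutoffPackage

open Literature.MathematicalPhysics.QuantumFieldTheory.Balaban1983to89
open Literature.MathematicalPhysics.QuantumFieldTheory.Balaban1983to89.T3ContinuumYM3Torus
open T3SectALandauChart (covDerivFwdT bgUnits eta eta_pos)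
open B9Eq39Adjoint (R covD covDstar divB)
open B9TorusCalculus (torusT torusT_apply torusT_symm_apply)
open B11Eq103H1Complex (SiteL2K BondL2K)
open Summit.QuantumFields.YangMills.Theorems.Prop7SectET3Transport (periodsT3)
open Summit.QuantumFields.YangMills.Theorems.Prop7SectET3HilbertLetters (W₂ toL2 toL2S DL2 DstarL2 covLapSite)
open Summit.QuantumFields.YangMills.Theorems.Prop7SecondOrderDict (covDerivFwdT_eq_smul_covD)
open Summit.QuantumFields.YangMills.Theorems.Prop7LandauDict (DL2_toL2S_eq_covDerivFwdT)
open Summit.QuantumFields.YangMills.Theorems.Prop7DivSliceOfMemberDivSq (inv_eta_sq_eq)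
open Summit.QuantumFields.YangMills.Theorems.Prop7LaplaceAFlatLetters (norm_sq_toL2 norm_sq_toL2S)
open Summit.QuantumFields.YangMills.Theorems.Prop7CovAgmonLetters (hs_smul)
open Summit.QuantumFields.YangMills.Theorems.Prop7ConjFrameTransport (divB_covD_smul_fun)
open Summit.QuantumFields.YangMills.Theorems.Prop7Lane2CutoffCommutators (DL2_smul_sub_smul_eq_toL2 covLapSite_comm_apply covLapSite_comm_eq_toL2S)
open Summit.QuantumFields.YangMills.Theorems.Prop7Lane2CutoffFamilyRows (hs_sum_grad_comm_le hs_sum_lap_comm_le)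
open Summit.QuantumFields.YangMills.Theorems.Prop7Lane2PartitionOfUnity (exists_partitionOfUnity one_le_M)
open Finset

variable (F : T3Family) (n K : ℕ) (c₀ : ℝ) [Fact (0 < c₀)] (W : GaugeField (F.P K) 0 (Matrix.specialUnitaryGroup (Fin 2) ℂ))

/-! ## §1 Two dictionary letters -/

/-- `‖D_W(toL2S λ)‖² = c₀·η⁻²·Σ_x Σ_μ hs(D_μλ(x))` in the `covD (torusT)` letters. [cite: Balaban1985BackgroundPropagators, (3.3) p.391, (3.11) p.392] -/
theorem norm_sq_DL2_toL2S_covD (l : Site (F.P K) 0 → Matrix (Fin 2) (Fin 2) ℂ) :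
    ‖DL2 F n K c₀ W (toL2S F K c₀ l)‖ ^ 2
      = c₀ * ((eta F n K)⁻¹) ^ 2 * ∑ x : Site (F.P K) 0, ∑ μ : Fin (F.P K).d, ∑ j : Fin 2, ∑ k' : Fin 2,
          ‖(covD (torusT (F.P K) 0) (fun μ z => bgUnits F K W ⟨z, μ⟩) μ l x) j k'‖ ^ 2 := by
  have hfun : DL2 F n K c₀ W (toL2S F K c₀ l)
      = toL2 F K c₀ (fun b => (eta F n K)⁻¹ • covD (torusT (F.P K) 0) (fun μ z => bgUnits F K W ⟨z, μ⟩) b.dir l b.src) := by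
    apply (toL2 F K c₀).symm.injective
    rw [LinearEquiv.symm_apply_apply]
    funext b
    rw [DL2_toL2S_eq_covDerivFwdT, covDerivFwdT_eq_smul_covD]
  rw [hfun, norm_sq_toL2, B10StarCount.sum_pbond (fun b : PBond (F.P K) 0 => ∑ i : Fin 2, ∑ i' : Fin 2,
    ‖((eta F n K)⁻¹ • covD (torusT (F.P K) 0) (fun μ z => bgUnits F K W ⟨z, μ⟩) b.dir l b.src) i i'‖ ^ 2)]
  simp only [hs_smul (N := 2), ← Finset.mul_sum]
  ring

variable {ι : Type*} [Fintype ι] (ζ : ι → Site (F.P K) 0 → ℝ) (l : ι → Site (F.P K) 0 → Matrix (Fin 2) (Fin 2) ℂ)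

/-- The family-summed Laplacian commutator on the functions, in the bracket form of ✓`divB_covD_smul_fun`. [cite: Balaban1985BackgroundPropagators, (3.100) p.413, (3.23) p.394] -/
theorem covLapSite_comm_sum_apply (x : Site (F.P K) 0) :
    ∑ c : ι, ((toL2S F K c₀).symm (covLapSite F n K c₀ W (toL2S F K c₀ (fun z => ζ c z • l c z))) x
        - ζ c x • (toL2S F K c₀).symm (covLapSite F n K c₀ W (toL2S F K c₀ (l c))) x)
      = (((eta F n K)⁻¹) ^ 2) • ∑ c : ι, ∑ μ : Fin (F.P K).d,
          ((ζ c x - ζ c (x.unshift μ)) • covDstar (torusT (F.P K) 0) (fun μ z => bgUnits F K W ⟨z, μ⟩) μ (l c) x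
            - (ζ c (x.shift μ) - ζ c x) • covD (torusT (F.P K) 0) (fun μ z => bgUnits F K W ⟨z, μ⟩) μ (l c) x
            - ((ζ c (x.shift μ) - ζ c x) - (ζ c x - ζ c (x.unshift μ))) • l c x) := by
  rw [Finset.smul_sum]
  refine Finset.sum_congr rfl fun c _ => ?_
  rw [covLapSite_comm_apply, divB_covD_smul_fun, add_sub_cancel_left]
  rfl

/-! ## §2 ★★★ The package -/

/-- ★★★ **THE (B6) CUTOFF PACKAGE IN (B7-CORE)'s SLOT SHAPES** — see the module docstring for the displayed rows (Z1)(Z2)(R1)(R2) and the re-exported p.o.u. rows.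
[cite: Balaban1985BackgroundPropagators, (3.100) pp.413–414] -/
theorem exists_cutoffPackage (s : ℕ) (hnK : n < K) (hs : s < F.m + n) :
    ∃ (Zc : Finset (Site (F.P K) 0)) (ζ : Site (F.P K) 0 → Site (F.P K) 0 → ℝ)
      (Zs : Site (F.P K) 0 → (SiteL2K ℂ 3 (periodsT3 F K) c₀ W₂ →ₗ[ℂ] SiteL2K ℂ 3 (periodsT3 F K) c₀ W₂))
      (Zb : Site (F.P K) 0 → (BondL2K ℂ 3 (periodsT3 F K) c₀ W₂ →ₗ[ℂ] BondL2K ℂ 3 (periodsT3 F K) c₀ W₂)),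
      -- the p.o.u. rows of `ζ`
      (∀ c x, 0 ≤ ζ c x ∧ ζ c x ≤ 1) ∧ (∀ x, ∑ c ∈ Zc, ζ c x = 1) ∧ (∀ c, c ∉ Zc → ∀ x, ζ c x = 0) ∧
      (∀ c x, ζ c x ≠ 0 → ∀ κ : Fin 3, min (x κ - c κ).val (c κ - x κ).val < F.L ^ s * F.L ^ (K - n)) ∧
      (∀ x, (Zc.filter (fun c => ζ c x ≠ 0)).card ≤ 8) ∧
      (∀ c x (μ : Fin 3), |ζ c (x.shift μ) - ζ c x| ≤ 3 / 2 / ((F.L : ℝ) ^ s * (F.L : ℝ) ^ (K - n)) ∧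
        |ζ c (x.unshift μ) - ζ c x| ≤ 3 / 2 / ((F.L : ℝ) ^ s * (F.L : ℝ) ^ (K - n))) ∧
      (∀ c x (μ : Fin 3), |ζ c (x.shift μ) + ζ c (x.unshift μ) - 2 * ζ c x| ≤ 6 / ((F.L : ℝ) ^ s * (F.L : ℝ) ^ (K - n)) ^ 2) ∧
      -- (Z2) the readings
      (∀ c φ x, (toL2S F K c₀).symm (Zs c φ) x = ζ c x • (toL2S F K c₀).symm φ x) ∧
      (∀ c f b, (toL2 F K c₀).symm (Zb c f) b = ζ c b.src • (toL2 F K c₀).symm f b) ∧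
      -- (Z1) partition of unity as operators
      (∀ φ, ∑ c : Site (F.P K) 0, Zs c φ = φ) ∧ (∀ f, ∑ c : Site (F.P K) 0, Zb c f = f) ∧
      -- (R1) the summed gradient commutator
      (∀ φ : Site (F.P K) 0 → SiteL2K ℂ 3 (periodsT3 F K) c₀ W₂,
        ‖∑ c : Site (F.P K) 0, (DL2 F n K c₀ W (Zs c (φ c)) - Zb c (DL2 F n K c₀ W (φ c)))‖ ^ 2
          ≤ 108 * (((F.L : ℝ) ^ s) ^ 2)⁻¹ * ∑ c : Site (F.P K) 0, ‖φ c‖ ^ 2) ∧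
      -- (R2) the summed Laplacian commutator
      (∀ φ : Site (F.P K) 0 → SiteL2K ℂ 3 (periodsT3 F K) c₀ W₂,
        ‖∑ c : Site (F.P K) 0, (covLapSite F n K c₀ W (Zs c (φ c)) - Zs c (covLapSite F n K c₀ W (φ c)))‖ ^ 2
          ≤ 648 * (((F.L : ℝ) ^ s) ^ 2)⁻¹ * ∑ c : Site (F.P K) 0, ‖DL2 F n K c₀ W (φ c)‖ ^ 2
            + 23328 * ((((F.L : ℝ) ^ s) ^ 2) ^ 2)⁻¹ * ∑ c : Site (F.P K) 0, ‖φ c‖ ^ 2) := by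
  classical
  obtain ⟨Zc, ζ, h01, hsum1, hoff, hsupp, hcard, hstep, hsec⟩ := exists_partitionOfUnity F n K s hnK hs
  -- letters
  have hc : (0 : ℝ) < c₀ := Fact.out
  have hL : (0 : ℝ) < F.L := by have := F.hL.2; exact_mod_cast (by omega : 0 < F.L)
  set M : ℝ := (F.L : ℝ) ^ s * (F.L : ℝ) ^ (K - n) with hM
  have hM0 : 0 < M := by positivity
  have hη : (eta F n K)⁻¹ = (F.L : ℝ) ^ (K - n) := by rw [T3SectALandauChart.eta, ← inv_pow, inv_inv]
  -- the multiplication maps on the functions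
  let mS : Site (F.P K) 0 → ((Site (F.P K) 0 → Matrix (Fin 2) (Fin 2) ℂ) →ₗ[ℂ] (Site (F.P K) 0 → Matrix (Fin 2) (Fin 2) ℂ)) := fun c =>
    { toFun := fun g x => ((ζ c x : ℝ) : ℂ) • g x
      map_add' := fun g g' => by funext x; simp only [Pi.add_apply, smul_add]
      map_smul' := fun r g => by funext x; simp only [Pi.smul_apply, RingHom.id_apply, smul_comm r] }
  let mB : Site (F.P K) 0 → ((PBond (F.P K) 0 → Matrix (Fin 2) (Fin 2) ℂ) →ₗ[ℂ] (PBond (F.P K) 0 → Matrix (Fin 2) (Fin 2) ℂ)) := fun c =>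
    { toFun := fun g b => ((ζ c b.src : ℝ) : ℂ) • g b
      map_add' := fun g g' => by funext b; simp only [Pi.add_apply, smul_add]
      map_smul' := fun r g => by funext b; simp only [Pi.smul_apply, RingHom.id_apply, smul_comm r] }
  let Zs : Site (F.P K) 0 → (SiteL2K ℂ 3 (periodsT3 F K) c₀ W₂ →ₗ[ℂ] SiteL2K ℂ 3 (periodsT3 F K) c₀ W₂) := fun c =>
    (toL2S F K c₀).toLinearMap ∘ₗ mS c ∘ₗ (toL2S F K c₀).symm.toLinearMap
  let Zb : Site (F.P K) 0 → (BondL2K ℂ 3 (periodsT3 F K) c₀ W₂ →ₗ[ℂ] BondL2K ℂ 3 (periodsT3 F K) c₀ W₂) := fun c =>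
    (toL2 F K c₀).toLinearMap ∘ₗ mB c ∘ₗ (toL2 F K c₀).symm.toLinearMap
  -- (Z2) readings
  have hZs : ∀ c φ x, (toL2S F K c₀).symm (Zs c φ) x = ζ c x • (toL2S F K c₀).symm φ x := by
    intro c φ x
    show (toL2S F K c₀).symm (toL2S F K c₀ (mS c ((toL2S F K c₀).symm φ))) x = _
    rw [LinearEquiv.symm_apply_apply]
    exact Complex.coe_smul _ _
  have hZb : ∀ c f b, (toL2 F K c₀).symm (Zb c f) b = ζ c b.src • (toL2 F K c₀).symm f b := by
    intro c f b
    show (toL2 F K c₀).symm (toL2 F K c₀ (mB c ((toL2 F K c₀).symm f))) b = _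
    rw [LinearEquiv.symm_apply_apply]
    exact Complex.coe_smul _ _
  -- the whole family sums to one at every site (off `Zc` the cutoffs vanish)
  have hsumAll : ∀ x, ∑ c : Site (F.P K) 0, ζ c x = 1 := by
    intro x
    rw [← Finset.sum_subset (Finset.subset_univ Zc) fun c _ hc => hoff c hc x]
    exact hsum1 x
  -- function-side form of `Zs c φ`, `Zb c f`
  have hZs_eq : ∀ c φ, Zs c φ = toL2S F K c₀ (fun x => ζ c x • (toL2S F K c₀).symm φ x) := by
    intro c φ
    apply (toL2S F K c₀).symm.injective
    rw [LinearEquiv.symm_apply_apply]; funext x; exact hZs c φ x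
  have hZb_eq : ∀ c f, Zb c f = toL2 F K c₀ (fun b => ζ c b.src • (toL2 F K c₀).symm f b) := by
    intro c f
    apply (toL2 F K c₀).symm.injective
    rw [LinearEquiv.symm_apply_apply]; funext b; exact hZb c f b
  refine ⟨Zc, ζ, Zs, Zb, h01, hsum1, hoff, hsupp, hcard, hstep, hsec, hZs, hZb, ?_, ?_, ?_, ?_⟩
  -- (Z1) sites
  · intro φ
    apply (toL2S F K c₀).symm.injective
    rw [map_sum]
    funext x
    rw [Finset.sum_apply, Finset.sum_congr rfl fun c _ => hZs c φ x, ← Finset.sum_smul, hsumAll x, one_smul]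
  -- (Z1) bonds
  · intro f
    apply (toL2 F K c₀).symm.injective
    rw [map_sum]
    funext b
    rw [Finset.sum_apply, Finset.sum_congr rfl fun c _ => hZb c f b, ← Finset.sum_smul, hsumAll b.src, one_smul]
  -- (R1)
  · intro φ
    set lf : Site (F.P K) 0 → Site (F.P K) 0 → Matrix (Fin 2) (Fin 2) ℂ := fun c => (toL2S F K c₀).symm (φ c) with hlf
    have hφ : ∀ c, φ c = toL2S F K c₀ (lf c) := fun c => by rw [hlf, LinearEquiv.apply_symm_apply]
    -- each summand is a `toL2` image (FILE 1), so the sum is one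
    have hterm : ∀ c : Site (F.P K) 0, DL2 F n K c₀ W (Zs c (φ c)) - Zb c (DL2 F n K c₀ W (φ c))
        = toL2 F K c₀ (fun b => ((eta F n K)⁻¹ * (ζ c b.tgt - ζ c b.src)) • R (bgUnits F K W b) (lf c b.tgt)) := by
      intro c
      rw [hZs_eq, hZb_eq, ← DL2_smul_sub_smul_eq_toL2 F n K c₀ W (ζ c) (lf c), hφ c, LinearEquiv.symm_apply_apply]
    have hvec : ∑ c : Site (F.P K) 0, (DL2 F n K c₀ W (Zs c (φ c)) - Zb c (DL2 F n K c₀ W (φ c)))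
        = toL2 F K c₀ (fun b => ∑ c : Site (F.P K) 0, ((eta F n K)⁻¹ * (ζ c b.tgt - ζ c b.src)) • R (bgUnits F K W b) (lf c b.tgt)) := by
      rw [Finset.sum_congr rfl fun c _ => hterm c, ← map_sum]
      congr 1; funext b; rw [Finset.sum_apply]
    rw [hvec, norm_sq_toL2]
    have h8 : ∀ y : Site (F.P K) 0, (Finset.univ.filter fun c : Site (F.P K) 0 => ζ c y ≠ 0).card ≤ 8 := by
      intro y
      have hsub : (Finset.univ.filter fun c : Site (F.P K) 0 => ζ c y ≠ 0) ⊆ Zc.filter (fun c => ζ c y ≠ 0) := by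
        intro c hc'
        rw [Finset.mem_filter] at hc' ⊢
        refine ⟨?_, hc'.2⟩
        by_contra h
        exact hc'.2 (hoff c h y)
      exact (Finset.card_le_card hsub).trans (hcard y)
    have hrow := hs_sum_grad_comm_le F n K c₀ W ζ lf (k := 8) (a := 3 / 2 / M) (by positivity) h8 (fun c x μ => (hstep c x μ).1)
    refine hrow.trans (le_of_eq ?_)
    have hnorm : ∀ c, c₀ * ∑ x : Site (F.P K) 0, ∑ j : Fin 2, ∑ k' : Fin 2, ‖lf c x j k'‖ ^ 2 = ‖φ c‖ ^ 2 := fun c => by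
      rw [hφ c, norm_sq_toL2S]
    simp only [hnorm]
    rw [hη, hM]
    field_simp
    ring
  -- (R2)
  · intro φ
    set lf : Site (F.P K) 0 → Site (F.P K) 0 → Matrix (Fin 2) (Fin 2) ℂ := fun c => (toL2S F K c₀).symm (φ c) with hlf
    have hφ : ∀ c, φ c = toL2S F K c₀ (lf c) := fun c => by rw [hlf, LinearEquiv.apply_symm_apply]
    have hterm : ∀ c : Site (F.P K) 0, covLapSite F n K c₀ W (Zs c (φ c)) - Zs c (covLapSite F n K c₀ W (φ c))
        = toL2S F K c₀ (fun x => (toL2S F K c₀).symm (covLapSite F n K c₀ W (toL2S F K c₀ (fun z => ζ c z • lf c z))) x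
            - ζ c x • (toL2S F K c₀).symm (covLapSite F n K c₀ W (toL2S F K c₀ (lf c))) x) := by
      intro c
      rw [hZs_eq, hZs_eq, ← covLapSite_comm_eq_toL2S F n K c₀ W (ζ c) (lf c), hφ c, LinearEquiv.symm_apply_apply]
    have hvec : ∑ c : Site (F.P K) 0, (covLapSite F n K c₀ W (Zs c (φ c)) - Zs c (covLapSite F n K c₀ W (φ c)))
        = toL2S F K c₀ (fun x => (((eta F n K)⁻¹) ^ 2) • ∑ c : Site (F.P K) 0, ∑ μ : Fin (F.P K).d,
            ((ζ c x - ζ c (x.unshift μ)) • covDstar (torusT (F.P K) 0) (fun μ z => bgUnits F K W ⟨z, μ⟩) μ (lf c) x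
              - (ζ c (x.shift μ) - ζ c x) • covD (torusT (F.P K) 0) (fun μ z => bgUnits F K W ⟨z, μ⟩) μ (lf c) x
              - ((ζ c (x.shift μ) - ζ c x) - (ζ c x - ζ c (x.unshift μ))) • lf c x)) := by
      rw [Finset.sum_congr rfl fun c _ => hterm c, ← map_sum]
      congr 1; funext x
      rw [Finset.sum_apply]
      exact covLapSite_comm_sum_apply F n K c₀ W ζ lf x
    rw [hvec, norm_sq_toL2S]
    have h8 : ∀ y : Site (F.P K) 0, (Finset.univ.filter fun c : Site (F.P K) 0 => ζ c y ≠ 0).card ≤ 8 := by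
      intro y
      have hsub : (Finset.univ.filter fun c : Site (F.P K) 0 => ζ c y ≠ 0) ⊆ Zc.filter (fun c => ζ c y ≠ 0) := by
        intro c hc'
        rw [Finset.mem_filter] at hc' ⊢
        refine ⟨?_, hc'.2⟩
        by_contra h
        exact hc'.2 (hoff c h y)
      exact (Finset.card_le_card hsub).trans (hcard y)
    have hrow := hs_sum_lap_comm_le F n K c₀ W ζ lf (k := 8) (a := 3 / 2 / M) (a₂ := 6 / M ^ 2) (by positivity) (by positivity) h8
      (fun c x μ => hstep c x μ) (fun c x μ => hsec c x μ)
    refine hrow.trans (le_of_eq ?_)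
    have hnorm : ∀ c, c₀ * ∑ x : Site (F.P K) 0, ∑ j : Fin 2, ∑ k' : Fin 2, ‖lf c x j k'‖ ^ 2 = ‖φ c‖ ^ 2 := fun c => by
      rw [hφ c, norm_sq_toL2S]
    have hgrad : ∀ c, c₀ * ((eta F n K)⁻¹) ^ 2 * ∑ x : Site (F.P K) 0, ∑ μ : Fin (F.P K).d, ∑ j : Fin 2, ∑ k' : Fin 2,
        ‖(covD (torusT (F.P K) 0) (fun μ z => bgUnits F K W ⟨z, μ⟩) μ (lf c) x) j k'‖ ^ 2 = ‖DL2 F n K c₀ W (φ c)‖ ^ 2 := fun c => by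
      rw [hφ c, norm_sq_DL2_toL2S_covD]
    simp only [hnorm, hgrad]
    rw [hη, hM]
    field_simp
    ring

end Summit.QuantumFields.YangMills.Theorems.Prop7Lane2CutoffPackage

end
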